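import Literature.MathematicalPhysics.QuantumFieldTheory.YangMillsOS

/-!
# Stub `stub_rateDilution` of line `Sketch` (AF-staircase transport) for crux stmt-QuantumFields-8761
(`Summit.QuantumFields.YangMills.Theses.EquipartitionCriticality.LatticeGapLargeBeta`)

Rate dilution for the clustering currency: a bound `|c n| ≤ K a b e^{2 m w} e^{-m n}` with a
(β-dependent) prefactor `K ≥ 2`, together with the a priori bound `|c n| ≤ 2 a b`, gives the
`K`-free constant `2 e^{2 w + 1} a b` at the price of the diluted, still positive, rate
`m' = m · log 2 / log K`.  Pure real analysis (two regimes `m' n ≤ / > 2 w + 1`).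
-/

noncomputable section

open scoped BigOperators Topology
open MeasureTheory ProbabilityTheory Filter
open Literature.MathematicalPhysics.QuantumFieldTheory Literature.MathematicalPhysics.QuantumLattice

namespace Summit.QuantumFields.YangMills.Theorems.LatticeGapLargeBeta.AfStaircase

/-- `log 2 ≤ 1` (from `log x ≤ x - 1`). -/
private theorem log_two_le_one : Real.log 2 ≤ 1 := by
  have h := Real.log_le_sub_one_of_pos (two_pos : (0 : ℝ) < 2)
  linarith

/-- For `K ≥ 2`: `0 < log 2 ≤ log K`. -/
private theorem log_two_le_log {K : ℝ} (hK : 2 ≤ K) :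
    0 < Real.log 2 ∧ Real.log 2 ≤ Real.log K :=
  ⟨Real.log_pos one_lt_two, Real.log_le_log two_pos hK⟩

/-- **Exponent comparison in the large-`n` regime.**  With `q = m n log 2 / log K` the diluted
exponent (encoded multiplicatively as `q · log K = m n log 2`), if `q > 1` then
`log K + 2 m w - m n ≤ log 2 + (2 w + 1) - q`.  Indeed `q > 1` forces `m n ≥ log K`, whence
`(m n - q) = (m n / log K)(log K - log 2) ≥ log K - log 2`, and `2 m w ≤ 2 w` as `m ≤ 1`. -/
private theorem exponent_le_of_one_lt {K m w n q : ℝ} (hK : 2 ≤ K) (hm : 0 < m) (hm1 : m ≤ 1)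
    (hw : 0 ≤ w) (hn : 0 ≤ n) (hq : q * Real.log K = m * n * Real.log 2) (hcase : 1 < q) :
    Real.log K + m * (2 * w) + -(m * n) ≤ Real.log 2 + (2 * w + 1) + -q := by
  obtain ⟨hlog2, hlogK⟩ := log_two_le_log hK
  have hlogK0 : 0 < Real.log K := lt_of_lt_of_le hlog2 hlogK
  have hl21 : Real.log 2 ≤ 1 := log_two_le_one
  have hmn0 : 0 ≤ m * n := mul_nonneg hm.le hn
  -- `log K < q log K = m n log 2 ≤ m n`
  have hA : Real.log K < m * n * Real.log 2 := by
    have h := mul_lt_mul_of_pos_left hcase hlogK0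
    linarith [h, hq]
  have hB : Real.log K ≤ m * n := by
    have h := mul_le_mul_of_nonneg_left hl21 hmn0
    linarith
  have hKl : 0 ≤ Real.log K - Real.log 2 := sub_nonneg.mpr hlogK
  -- `log K - log 2 ≤ m n - q`, after multiplying through by `log K > 0`
  have hC : Real.log K - Real.log 2 ≤ m * n - q := by
    refine le_of_mul_le_mul_right ?_ hlogK0
    have hprod : (Real.log K - Real.log 2) * Real.log K ≤ (Real.log K - Real.log 2) * (m * n) :=
      mul_le_mul_of_nonneg_left hB hKl
    linarith [hprod, hq]
  -- `2 m w ≤ 2 w`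
  have hD : m * (2 * w) ≤ 2 * w := by
    have h := mul_le_mul_of_nonneg_right hm1 (by positivity : (0 : ℝ) ≤ 2 * w)
    linarith
  linarith

/-- **Prefactor comparison in the large-`n` regime**: exponentiating `exponent_le_of_one_lt`,
`K e^{2 m w} e^{-m n} ≤ 2 e^{2 w + 1} e^{-q}` whenever `q > 1` (`q · log K = m n log 2`). -/
private theorem prefactor_le_of_one_lt {K m w n q : ℝ} (hK : 2 ≤ K) (hm : 0 < m) (hm1 : m ≤ 1)
    (hw : 0 ≤ w) (hn : 0 ≤ n) (hq : q * Real.log K = m * n * Real.log 2) (hcase : 1 < q) :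
    K * Real.exp (m * (2 * w)) * Real.exp (-(m * n)) ≤
      2 * Real.exp (2 * w + 1) * Real.exp (-q) := by
  have hK0 : 0 < K := by linarith
  have h := Real.exp_le_exp.mpr (exponent_le_of_one_lt hK hm hm1 hw hn hq hcase)
  rwa [Real.exp_add, Real.exp_add, Real.exp_add, Real.exp_add, Real.exp_log hK0,
    Real.exp_log two_pos] at h

/-- `stub_rateDilution` — **rate dilution for the AF-staircase clustering currency** (pure real
analysis).  If `|c n| ≤ 2 a b` and `|c n| ≤ K a b e^{2 m w} e^{-m n}` for `n ≤ S`, with `a, b ≥ 0`,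
`K ≥ 2`, `0 < m ≤ 1`, then `|c n| ≤ 2 e^{2 w + 1} a b e^{-m' n}` for `n ≤ S`, where
`m' = m log 2 / log K ∈ (0, m]`: the `β`-dependent prefactor `K` is traded for a diluted rate and the
`K`-free constant `2 e^{2 w + 1} a b`.  Two regimes: for `m' n ≤ 2 w + 1` use the a priori bound and
`1 ≤ e^{2 w + 1 - m' n}`; for `m' n > 2 w + 1` one has `m n ≥ log K`, so
`log K + 2 m w - m n ≤ log 2 + 2 w + 1 - m' n`, and exponentiate. [folklore] -/
theorem stub_rateDilution :
    ∀ (c : ℕ → ℝ) (a b K m : ℝ) (w S : ℕ), 0 ≤ a → 0 ≤ b → 2 ≤ K → 0 < m → m ≤ 1 →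
      (∀ n : ℕ, n ≤ S → |c n| ≤ 2 * a * b) →
      (∀ n : ℕ, n ≤ S → |c n| ≤ K * a * b * Real.exp (m * (2 * w)) * Real.exp (-(m * n))) →
      ∀ n : ℕ, n ≤ S →
        |c n| ≤ 2 * Real.exp (2 * w + 1) * a * b * Real.exp (-(m * Real.log 2 / Real.log K * n)) := by
  intro c a b K m w S ha hb hK hm hm1 hsmall hlarge n hn
  have hab : 0 ≤ a * b := mul_nonneg ha hb
  have hw : (0 : ℝ) ≤ (w : ℝ) := Nat.cast_nonneg w
  have hn0 : (0 : ℝ) ≤ (n : ℝ) := Nat.cast_nonneg n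
  rcases le_or_gt (m * Real.log 2 / Real.log K * (n : ℝ)) (2 * (w : ℝ) + 1) with hcase | hcase
  · -- small-`n` regime: the a priori bound and `1 ≤ e^{2 w + 1 - m' n}`
    have hexp : 1 ≤ Real.exp (2 * (w : ℝ) + 1) * Real.exp (-(m * Real.log 2 / Real.log K * n)) := by
      rw [← Real.exp_add]
      exact Real.one_le_exp (by linarith)
    calc |c n| ≤ 2 * a * b := hsmall n hn
      _ = 2 * (a * b) * 1 := by ring
      _ ≤ 2 * (a * b) * (Real.exp (2 * (w : ℝ) + 1) *
            Real.exp (-(m * Real.log 2 / Real.log K * n))) :=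
          mul_le_mul_of_nonneg_left hexp (by positivity)
      _ = 2 * Real.exp (2 * w + 1) * a * b * Real.exp (-(m * Real.log 2 / Real.log K * n)) := by
          ring
  · -- large-`n` regime: compare the prefactors and multiply by `a b ≥ 0`
    obtain ⟨hlog2, hlogK⟩ := log_two_le_log hK
    have hne : Real.log K ≠ 0 := (lt_of_lt_of_le hlog2 hlogK).ne'
    have hq : m * Real.log 2 / Real.log K * n * Real.log K = m * n * Real.log 2 := by
      calc m * Real.log 2 / Real.log K * n * Real.log K
          = m * n * Real.log 2 * (Real.log K / Real.log K) := by ring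
        _ = m * n * Real.log 2 := by rw [div_self hne, mul_one]
    have h1 : (1 : ℝ) < m * Real.log 2 / Real.log K * n := by linarith
    have hpref := prefactor_le_of_one_lt hK hm hm1 hw hn0 hq h1
    calc |c n| ≤ K * a * b * Real.exp (m * (2 * w)) * Real.exp (-(m * n)) := hlarge n hn
      _ = a * b * (K * Real.exp (m * (2 * w)) * Real.exp (-(m * n))) := by ring
      _ ≤ a * b * (2 * Real.exp (2 * (w : ℝ) + 1) *
            Real.exp (-(m * Real.log 2 / Real.log K * n))) :=
          mul_le_mul_of_nonneg_left hpref hab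
      _ = 2 * Real.exp (2 * w + 1) * a * b * Real.exp (-(m * Real.log 2 / Real.log K * n)) := by
          ring

end Summit.QuantumFields.YangMills.Theorems.LatticeGapLargeBeta.AfStaircase

end
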